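import Summits.NavierStokesRegularity.NavierStokesRegularity.Theorems.ExtremiserTransienceNearExtremalTransienceExtremiserLiouvilleConstantSpeedMultiplierMeasure
import HarnessLib

/-!
# Crux `ExtremiserTransience.NearExtremalTransience` (stmt-NavierStokesRegularity-21883), line `extremiser_liouville`,
# stub K1b — SECOND-ORDER KKT CONDITION OF A CONSTANT-SPEED EXTENDED EXTREMISER

`--supports stmt-NavierStokesRegularity-21883` (helper).  Author: prover seat `ns-el-k1b` (g3).

For the K1b residue object `v` (`‖v‖ ≡ M`, extremal `|S| = κ⋆M√Z√W`, notation of `…KStarAttainedHalfSpaceVariation`) and a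
smooth compactly supported divergence-free `φ` with `⟪v, φ⟫ ≤ s` and `‖φ‖² ≤ P` pointwise, the comparison function
`f(ε) = J(v+εφ)² − κ⋆²(M² + 2εs + ε²P)·Z(v+εφ)·W(v+εφ)` is `≤ 0` for `ε ≥ 0` (`‖v + εφ‖² = M² + 2ε⟪v,φ⟫ + ε²‖φ‖²` and
universality of `κ⋆` on the extended class, `extendedSharp`) and `f(0) = 0`.  First order gives the KKT inequality
(p641635).  **If the KKT inequality is TIGHT for `φ`** — `ℓ(φ) = κ⋆²ZW·s`, e.g. `s = 0` (inward `φ`, `⟪v,φ⟫ ≤ 0`) together with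
`ℓ(φ) = ∫⟪v,φ⟫dμ = 0` (`φ ⊥ v` on the support of the multiplier `μ` of `…ConstantSpeedMultiplierMeasure`) — then `f'(0) = 0`
and the SECOND-ORDER condition `f''(0) ≤ 0` holds:

* `quad_coeff_nonpos_of_sq_le` : one-sided second-order Fermat for the comparison polynomial (explicit expansion
  `f(ε) = f₀ + εf₁ + ε²f₂ + ε³R(ε)`, `f₂ ≤ 0` by `ε → 0⁺`);
* `ext_secondVariation_le` : **`J₁(φ)² + 2S·J₂(φ) ≤ κ⋆²·[P·ZW + 4s·(a₁(φ)W + c₁(φ)Z) + M²·(a₂(φ)W + 4a₁(φ)c₁(φ) + c₂(φ)Z)]`**,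
  where `J₂, a₂, c₂` are the quadratic coefficients of `S, Z, W` along `v + εφ` (`…KStarAttainedPerturbation`):
  `J₂(φ) = ∫(⟪curl φ, Dφ ω⟫ + ⟪curl φ, Dv curl φ⟫ + ⟪ω, Dφ curl φ⟫)`, `a₂(φ) = ‖curl φ‖₂²`, `c₂(φ) = ‖∇curl φ‖₂²`;
* `ext_secondVariation_le_of_inward` : the case `s = 0`: for inward tight directions (`⟪v,φ⟫ ≤ 0`, `ℓ(φ) = 0`)
  **`J₁² + 2S·J₂ ≤ κ⋆²[sup‖φ‖²·ZW + M²(a₂W + 4a₁c₁ + c₂Z)]`** — the stability (local maximality) condition a refuter must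
  violate to kill the residue object by a second-order perturbation.

WHAT THIS IS NOT: a necessary condition on the HYPOTHETICAL K1b residue object; K1b is NOT proved; nothing here proves
NS regularity. [folklore]
-/

noncomputable section

open Set Filter Topology MeasureTheory Metric Function
open scoped ENNReal NNReal Topology InnerProductSpace RealInnerProductSpace ContDiff
open Literature.Analysis.FluidPDE Literature.Analysis

namespace Summit.NavierStokesRegularity.NavierStokesRegularity.Theorems

-- the problem directory repeats the summit name (`NavierStokesRegularity/NavierStokesRegularity`)
set_option linter.dupNamespace false

namespace ExtremiserLiouville

open DepletionLadder.KStar DepletionLadder.KStar.HalfSpace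

variable {v φ : E3 → E3}

/-! ## One-sided second-order Fermat for the comparison polynomial -/

/-- If `(J + εJ₁ + ε²J₂ + ε³J₃)² ≤ K²(M² + 2εs + ε²P)(Z + 2εa₁ + ε²a₂)(W + 2εc₁ + ε²c₂)` for `0 ≤ ε < ε₁`, with vanishing
constant AND linear coefficients of the difference (`J² = K²M²ZW`, `J·J₁ = K²(sZW + M²(Wa₁ + Zc₁))`), then the quadratic
coefficient is `≤ 0`. [folklore] -/
theorem quad_coeff_nonpos_of_sq_le {J J₁ J₂ J₃ K M s P Z a₁ a₂ W c₁ c₂ ε₁ : ℝ} (hε₁ : 0 < ε₁)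
    (hf0 : J ^ 2 = K ^ 2 * M ^ 2 * Z * W)
    (hf1 : J * J₁ = K ^ 2 * (s * Z * W + M ^ 2 * (W * a₁ + Z * c₁)))
    (hle : ∀ ε, 0 ≤ ε → ε < ε₁ → (J + ε * J₁ + ε ^ 2 * J₂ + ε ^ 3 * J₃) ^ 2 ≤
        K ^ 2 * (M ^ 2 + 2 * ε * s + ε ^ 2 * P) * (Z + 2 * ε * a₁ + ε ^ 2 * a₂) * (W + 2 * ε * c₁ + ε ^ 2 * c₂)) :
    J₁ ^ 2 + 2 * J * J₂ ≤ K ^ 2 * (P * Z * W + 4 * s * (a₁ * W + c₁ * Z) + M ^ 2 * (a₂ * W + 4 * a₁ * c₁ + c₂ * Z)) := by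
  set Q : ℝ := J₁ ^ 2 + 2 * J * J₂ - K ^ 2 * (P * Z * W + 4 * s * (a₁ * W + c₁ * Z) + M ^ 2 * (a₂ * W + 4 * a₁ * c₁ + c₂ * Z))
    with hQ
  set R : ℝ → ℝ := fun ε =>
    (2 * J * J₃ + 2 * J₁ * J₂ - 2 * K ^ 2 * M ^ 2 * a₁ * c₂ - 2 * K ^ 2 * M ^ 2 * a₂ * c₁ - 2 * K ^ 2 * P * W * a₁ -
        2 * K ^ 2 * P * Z * c₁ - 2 * K ^ 2 * W * a₂ * s - 2 * K ^ 2 * Z * c₂ * s - 8 * K ^ 2 * a₁ * c₁ * s) +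
      ε * (2 * J₁ * J₃ + J₂ ^ 2 - K ^ 2 * M ^ 2 * a₂ * c₂ - K ^ 2 * P * W * a₂ - K ^ 2 * P * Z * c₂ - 4 * K ^ 2 * P * a₁ * c₁ -
        4 * K ^ 2 * a₁ * c₂ * s - 4 * K ^ 2 * a₂ * c₁ * s) +
      ε ^ 2 * (2 * J₂ * J₃ - 2 * K ^ 2 * P * a₁ * c₂ - 2 * K ^ 2 * P * a₂ * c₁ - 2 * K ^ 2 * a₂ * c₂ * s) +
      ε ^ 3 * (J₃ ^ 2 - K ^ 2 * P * a₂ * c₂) with hR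
  have hexp : ∀ ε : ℝ, (J + ε * J₁ + ε ^ 2 * J₂ + ε ^ 3 * J₃) ^ 2 -
      K ^ 2 * (M ^ 2 + 2 * ε * s + ε ^ 2 * P) * (Z + 2 * ε * a₁ + ε ^ 2 * a₂) * (W + 2 * ε * c₁ + ε ^ 2 * c₂) =
      (J ^ 2 - K ^ 2 * M ^ 2 * Z * W) + ε * (2 * (J * J₁ - K ^ 2 * (s * Z * W + M ^ 2 * (W * a₁ + Z * c₁)))) +
        ε ^ 2 * Q + ε ^ 3 * R ε := by
    intro ε
    simp only [hQ, hR]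
    ring
  have hQε : ∀ ε, 0 < ε → ε < ε₁ → Q + ε * R ε ≤ 0 := by
    intro ε hε hε'
    have h := hle ε hε.le hε'
    have h' : ε ^ 2 * (Q + ε * R ε) ≤ 0 := by
      have := hexp ε
      rw [hf0, hf1, sub_self, sub_self, mul_zero, mul_zero, zero_add, zero_add] at this
      nlinarith [this, h]
    by_contra hpos
    rw [not_le] at hpos
    exact absurd h' (not_le.2 (mul_pos (pow_pos hε 2) hpos))
  have hcont : Continuous fun ε : ℝ => Q + ε * R ε := by
    simp only [hR]
    fun_prop
  have htend : Tendsto (fun ε : ℝ => Q + ε * R ε) (𝓝[>] 0) (𝓝 Q) := by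
    have h := (hcont.tendsto 0).mono_left (nhdsWithin_le_nhds (s := Ioi (0 : ℝ)))
    simpa using h
  have hle0 : Q ≤ 0 :=
    le_of_tendsto htend (by
      filter_upwards [Ioo_mem_nhdsGT hε₁] with ε hε
      exact hQε ε hε.1 hε.2)
  linarith

/-! ## The second-order condition -/

/-- **Second-order KKT condition of a constant-speed extended extremiser along a tight direction.**  If `⟪v, φ⟫ ≤ s`,
`‖φ‖² ≤ P` pointwise and the KKT inequality is tight, `ℓ(φ) = κ⋆² Z W s`, then
`J₁² + 2S·J₂ ≤ κ⋆²[P·ZW + 4s(a₁W + c₁Z) + M²(a₂W + 4a₁c₁ + c₂Z)]`. [folklore] -/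
theorem ext_secondVariation_le (hv : ContDiff ℝ ∞ v) (hdiv : VectorCalculus.IsDivFree v) {M B : ℝ}
    (hM : ∀ x, ‖v x‖ = M) (hB : ∀ x, ‖fderiv ℝ v x‖ ≤ B)
    (h1 : ∫⁻ x, ‖iteratedFDeriv ℝ 1 v x‖ₑ ^ 2 < ⊤) (h2 : ∫⁻ x, ‖iteratedFDeriv ℝ 2 v x‖ₑ ^ 2 < ⊤)
    (hatt : |Jst v| = kStar * M * Real.sqrt (Zen v) * Real.sqrt (Wpa v))
    (hφ : ContDiff ℝ ∞ φ) (hφc : HasCompactSupport φ) (hφdiv : VectorCalculus.IsDivFree φ)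
    {s P : ℝ} (hs : ∀ x, ⟪v x, φ x⟫_ℝ ≤ s) (hP : ∀ x, ‖φ x‖ ^ 2 ≤ P)
    (htight : Jst v * J1 v φ - kStar ^ 2 * M ^ 2 * (Wpa v * A1 v φ + Zen v * C1 v φ) = kStar ^ 2 * Zen v * Wpa v * s) :
    J1 v φ ^ 2 + 2 * Jst v * (∫ x, (⟪curl φ x, fderiv ℝ φ x (curl v x)⟫_ℝ + ⟪curl φ x, fderiv ℝ v x (curl φ x)⟫_ℝ +
        ⟪curl v x, fderiv ℝ φ x (curl φ x)⟫_ℝ)) ≤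
      kStar ^ 2 * (P * Zen v * Wpa v + 4 * s * (A1 v φ * Wpa v + C1 v φ * Zen v) +
        M ^ 2 * ((∫ x, ‖curl φ x‖ ^ 2) * Wpa v + 4 * A1 v φ * C1 v φ +
          (∫ x, frobeniusNormSq (fderiv ℝ (curl φ) x)) * Zen v)) := by
  have hext := extendedSharp
  have hZ0 : 0 ≤ Zen v := integral_nonneg fun x => sq_nonneg _
  have hW0 : 0 ≤ Wpa v := integral_nonneg fun x => frobeniusNormSq_nonneg _
  have hvd : Differentiable ℝ v := hv.differentiable (by simp)
  have hφd : Differentiable ℝ φ := hφ.differentiable (by simp)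
  obtain ⟨C, hC⟩ := (hφ.continuous_fderiv (by simp)).bounded_above_of_compact_support (hφc.fderiv (𝕜 := ℝ))
  -- the pointwise norm bound `‖v + εφ‖² ≤ M² + 2εs + ε²P` for `ε ≥ 0`
  have hsq : ∀ ε : ℝ, 0 ≤ ε → ∀ x, ‖v x + ε • φ x‖ ^ 2 ≤ M ^ 2 + 2 * ε * s + ε ^ 2 * P := by
    intro ε hε x
    rw [norm_add_sq_real, norm_smul, Real.norm_eq_abs, abs_of_nonneg hε, inner_smul_right, hM x, mul_pow]
    nlinarith [hs x, hP x, mul_nonneg hε (sub_nonneg.2 (hs x)), mul_nonneg (sq_nonneg ε) (sub_nonneg.2 (hP x))]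
  have hnn : ∀ ε : ℝ, 0 ≤ ε → 0 ≤ M ^ 2 + 2 * ε * s + ε ^ 2 * P := fun ε hε => (sq_nonneg _).trans (hsq ε hε 0)
  have hbound : ∀ ε : ℝ, 0 ≤ ε → ∀ x, ‖v x + ε • φ x‖ ≤ Real.sqrt (M ^ 2 + 2 * ε * s + ε ^ 2 * P) := fun ε hε x =>
    Real.le_sqrt_of_sq_le (hsq ε hε x)
  refine quad_coeff_nonpos_of_sq_le one_pos (J₃ := ∫ x, ⟪curl φ x, fderiv ℝ φ x (curl φ x)⟫_ℝ) ?_ ?_ fun ε hε0 _ => ?_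
  · calc Jst v ^ 2 = |Jst v| ^ 2 := (sq_abs _).symm
      _ = (kStar * M * Real.sqrt (Zen v) * Real.sqrt (Wpa v)) ^ 2 := by rw [hatt]
      _ = kStar ^ 2 * M ^ 2 * Zen v * Wpa v := by rw [mul_pow, mul_pow, mul_pow, Real.sq_sqrt hZ0, Real.sq_sqrt hW0]
  · linear_combination htight
  · -- the perturbed field is in the extended class, with the bound `√(M² + 2εs + ε²P)`
    have hcd : ContDiff ℝ ∞ (fun y => v y + ε • φ y) := hv.add (hφ.const_smul ε)
    have hdv : VectorCalculus.IsDivFree (fun y => v y + ε • φ y) := fun x => by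
      rw [divergence_add_smul hvd hφd, hdiv x, hφdiv x, mul_zero, add_zero]
    have hB' : ∀ x, ‖fderiv ℝ (fun y => v y + ε • φ y) x‖ ≤ B + |ε| * C := fun x => by
      rw [fderiv_add_smul hvd hφd]
      calc ‖fderiv ℝ v x + ε • fderiv ℝ φ x‖ ≤ ‖fderiv ℝ v x‖ + ‖ε • fderiv ℝ φ x‖ := norm_add_le _ _
        _ = ‖fderiv ℝ v x‖ + |ε| * ‖fderiv ℝ φ x‖ := by rw [norm_smul, Real.norm_eq_abs]
        _ ≤ B + |ε| * C := add_le_add (hB x) (mul_le_mul_of_nonneg_left (hC x) (abs_nonneg ε))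
    have h1' := lintegral_iteratedFDeriv_add_smul_lt_top hv hφ hφc ε h1
    have h2' := lintegral_iteratedFDeriv_add_smul_lt_top hv hφ hφc ε h2
    have hu := hext _ (Real.sqrt (M ^ 2 + 2 * ε * s + ε ^ 2 * P)) (B + |ε| * C) hcd hdv (hbound ε hε0) hB' h1' h2'
    have hZε : 0 ≤ ∫ x, ‖curl (fun y => v y + ε • φ y) x‖ ^ 2 := integral_nonneg fun x => sq_nonneg _
    have hWε : 0 ≤ ∫ x, frobeniusNormSq (fderiv ℝ (curl (fun y => v y + ε • φ y)) x) :=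
      integral_nonneg fun x => frobeniusNormSq_nonneg _
    have hsq' : (∫ x, ⟪curl (fun y => v y + ε • φ y) x,
        fderiv ℝ (fun y => v y + ε • φ y) x (curl (fun y => v y + ε • φ y) x)⟫) ^ 2 ≤
        (kStar * Real.sqrt (M ^ 2 + 2 * ε * s + ε ^ 2 * P) * Real.sqrt (∫ x, ‖curl (fun y => v y + ε • φ y) x‖ ^ 2) *
          Real.sqrt (∫ x, frobeniusNormSq (fderiv ℝ (curl (fun y => v y + ε • φ y)) x))) ^ 2 := by
      rw [← sq_abs (∫ x, ⟪curl (fun y => v y + ε • φ y) x,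
        fderiv ℝ (fun y => v y + ε • φ y) x (curl (fun y => v y + ε • φ y) x)⟫)]
      exact pow_le_pow_left₀ (abs_nonneg _) hu 2
    rw [mul_pow, mul_pow, mul_pow, Real.sq_sqrt hZε, Real.sq_sqrt hWε, Real.sq_sqrt (hnn ε hε0),
      integral_stretching_add_smul hv hB h1 hφ hφc ε, integral_normSq_curl_add_smul hv h1 hφ hφc ε,
      integral_frobeniusNormSq_add_smul hv h2 hφ hφc ε] at hsq'
    exact hsq'

/-- **Second-order condition for tight INWARD directions** (`s = 0`): if `⟪v, φ⟫ ≤ 0` pointwise and `ℓ(φ) = 0` (e.g. `φ ⊥ v`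
on the support of the multiplier measure), then `J₁² + 2S·J₂ ≤ κ⋆²[P·ZW + M²(a₂W + 4a₁c₁ + c₂Z)]` for any bound
`‖φ‖² ≤ P`. [folklore] -/
theorem ext_secondVariation_le_of_inward (hv : ContDiff ℝ ∞ v) (hdiv : VectorCalculus.IsDivFree v) {M B : ℝ}
    (hM : ∀ x, ‖v x‖ = M) (hB : ∀ x, ‖fderiv ℝ v x‖ ≤ B)
    (h1 : ∫⁻ x, ‖iteratedFDeriv ℝ 1 v x‖ₑ ^ 2 < ⊤) (h2 : ∫⁻ x, ‖iteratedFDeriv ℝ 2 v x‖ₑ ^ 2 < ⊤)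
    (hatt : |Jst v| = kStar * M * Real.sqrt (Zen v) * Real.sqrt (Wpa v))
    (hφ : ContDiff ℝ ∞ φ) (hφc : HasCompactSupport φ) (hφdiv : VectorCalculus.IsDivFree φ)
    {P : ℝ} (hs : ∀ x, ⟪v x, φ x⟫_ℝ ≤ 0) (hP : ∀ x, ‖φ x‖ ^ 2 ≤ P)
    (hℓ : Jst v * J1 v φ - kStar ^ 2 * M ^ 2 * (Wpa v * A1 v φ + Zen v * C1 v φ) = 0) :
    J1 v φ ^ 2 + 2 * Jst v * (∫ x, (⟪curl φ x, fderiv ℝ φ x (curl v x)⟫_ℝ + ⟪curl φ x, fderiv ℝ v x (curl φ x)⟫_ℝ +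
        ⟪curl v x, fderiv ℝ φ x (curl φ x)⟫_ℝ)) ≤
      kStar ^ 2 * (P * Zen v * Wpa v +
        M ^ 2 * ((∫ x, ‖curl φ x‖ ^ 2) * Wpa v + 4 * A1 v φ * C1 v φ +
          (∫ x, frobeniusNormSq (fderiv ℝ (curl φ) x)) * Zen v)) := by
  have h := ext_secondVariation_le hv hdiv hM hB h1 h2 hatt hφ hφc hφdiv (s := 0) hs hP (by rw [hℓ]; ring)
  simpa only [mul_zero, zero_mul, add_zero] using h

end ExtremiserLiouville

end Summit.NavierStokesRegularity.NavierStokesRegularity.Theorems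

end
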